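import Literature.Geometry.Kaehler.ComplexTorusAnalyticCycleIntersectionNonneg
import Literature.Geometry.Kaehler.ComplexTorusProductL2
import Literature.Geometry.Kaehler.ComplexTorusHodgeClassesMaps
import Literature.Geometry.Kaehler.ComplexTorusWeilHodgeClasses
import HarnessLib

/-!
# The Euclidean presentation of a complex torus: the cycle-class obstruction in any model, and
# the explicit torus of Weil type carries no analytic hypersurface

The cycle-class files of rows A2/A4 of lane `lit-hodgefound` (`analyticCycleClass`, Lelong positivity,
`ComplexTorus.not_hasPureDim_of_forall_nonneg_integralHodgeClass_eq_zero`, row A4-104's `analyticClasses`)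
are written for a torus `X = E/Φ(ℤ^ι)` modelled on an INNER-PRODUCT space `E` (the fundamental class is an
integral against Hausdorff measure). Many explicit tori of the tree are modelled on the sup-normed
`Fin g → ℂ` (the torus of Weil type `Weil.periodEquiv`, Zucker's tori, Siegel-normalised period matrices),
where those files do not instantiate. A complex torus does not depend on the norm of its model: this file
provides the (tautological) change of model and transports the main OBSTRUCTION theorem to an arbitrary
finite-dimensional complex normed model.

* §1 `ComplexTorus.toEuclideanModel E : E ≃L[ℂ] EuclideanSpace ℂ (Fin (finrank ℂ E))` (a `ℂ`-linear
  homeomorphism onto the Euclidean model of the same dimension) and **`ComplexTorus.euclideanPresentation Φ`**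
  (the same lattice coordinates `(ℝ/ℤ)^ι`, model changed); the change of presentation `ρ(1)` is the identity
  on points and biholomorphic (`euclideanPresentationHomeomorph`, `mdifferentiable_…`), so closed analytic
  subsets of pure dimension / codimension correspond (`HasPureDim.euclideanPresentation`,
  `HasPureCodim.euclideanPresentation`; Chirka §2.3: biholomorphic invariance).
* §2 Forms: the analytic representation of `ρ(1)` is `toEuclideanModel E` (`realRep_one_euclideanPresentation`);
  pulling back along it identifies integral / rational / Hodge classes of the two presentations
  (`comp_toEuclideanModel_mem_integralHodgeClasses`, `…_mem_hodgeClasses`, `eq_zero_of_comp_toEuclideanModel_eq_zero`).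
* §3 **The obstruction in any model**: `ComplexTorus.not_hasPureDim_of_forall_integralHodgeClass_eq_zero` — if
  every integral class of type `(p,p)` of `X = E/Λ` vanishes (`H^{2p}(X, ℤ) ∩ H^{p,p} = 0`), then `X` has no
  closed analytic subset of pure codimension `p` (any finite-dimensional complex normed model `E`); the
  `B^p(X) = 0` and codimension forms (`…_of_hodgeClasses_eq_bot`, `not_hasPureCodim_of_hodgeClasses_eq_bot`).
  (Lelong: the class of a `d`-dimensional closed analytic subset is a NON-ZERO integral `(p,p)`-class,
  Griffiths–Harris Ch. 0 §2 / Ch. 3 §1; tree rows A2-113/A4 in the inner-product model, transported.)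
* §4 **Application — the explicit complex torus of Weil type `X = ℂ⁴/Φ(ℤ⁸)` (`Weil.periodEquiv`, model
  `Fin 4 → ℂ`) CARRIES NO ANALYTIC HYPERSURFACE** (`Weil.not_hasPureDim_three`, `Weil.not_hasPureCodim_one`):
  `NS(X) ⊗ ℚ = H²_Hodge(X) = 0` (`Weil.hodgeClasses_one_eq_bot`, Voisin 2002 §3 Prop. 3 (i)), hence no divisor
  — Voisin's assumption (b) in codimension one ("a torus with `X_a = 0` carries no analytic hypersurface",
  Lange 2023 §2.1.6 Exercise (8)(g); the statement recorded as not instantiable in the sup model in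
  `ComplexTorusAnalyticHypersurfaceAbelianQuotient`).

Definitions `toEuclideanModel`, `euclideanPresentation`, `euclideanPresentationHomeomorph`; theorems
otherwise; no named fact, no instance, no notation.

## References

* [Chirka1989] E. M. Chirka, Complex Analytic Sets (1989), §2.3 (regular points and dimension are
  biholomorphic invariants).
* [Lange2023AbelianVarietiesComplex] H. Lange, Abelian Varieties over the Complex Numbers (2023), §1.1.2
  Lemma 1.1.11 (analytic representations of homomorphisms), §2.1.6 Exercise (8)(g).
* [GriffithsHarrisPrinciples1978] P. Griffiths, J. Harris, Principles of Algebraic Geometry (1978), Ch. 0 §2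
  (Wirtinger), Ch. 3 §1 (Lelong: fundamental classes of analytic subvarieties).
* [Voisin2002KaehlerCounterexample] C. Voisin, IMRN 2002 no. 20, §2 (a)–(b), §3 Prop. 3.
-/

noncomputable section

open scoped Manifold ComplexOrder
open Complex Module Set Function
open Literature.Analysis.Complex (IsOfTypeAt)

namespace Literature.Geometry.Kaehler

namespace ComplexTorus

section Model

variable {ι : Type*} [Fintype ι] [DecidableEq ι] {E : Type*} [NormedAddCommGroup E] [NormedSpace ℂ E]
  [FiniteDimensional ℂ E] (Φ : (ι → ℝ) ≃L[ℝ] E)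

/-! ### §1 The Euclidean model and the Euclidean presentation -/

variable (E) in
/-- A `ℂ`-linear homeomorphism of the finite-dimensional complex normed space `E` onto the Euclidean model
`EuclideanSpace ℂ (Fin (dim E))` of the same dimension (any two complex normed spaces of the same finite
dimension are `ℂ`-linearly homeomorphic). [folklore] -/
def toEuclideanModel : E ≃L[ℂ] EuclideanSpace ℂ (Fin (finrank ℂ E)) :=
  ContinuousLinearEquiv.ofFinrankEq (by rw [finrank_euclideanSpace_fin])

omit [DecidableEq ι] in
/-- **The Euclidean presentation of the torus `E/Φ(ℤ^ι)`**: the same lattice coordinates, the model changed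
to `EuclideanSpace ℂ (Fin (dim E))` along `toEuclideanModel E`. The torus `ComplexTorus (euclideanPresentation Φ)`
has the same points `(ℝ/ℤ)^ι` as `ComplexTorus Φ` and the identity is biholomorphic
(`euclideanPresentationHomeomorph`). [cite: Lange2023AbelianVarietiesComplex, §1.1.2 Lemma 1.1.11] -/
def euclideanPresentation : (ι → ℝ) ≃L[ℝ] EuclideanSpace ℂ (Fin (finrank ℂ E)) :=
  (Φ.toLinearEquiv.trans ((toEuclideanModel E).toLinearEquiv.restrictScalars ℝ)).toContinuousLinearEquiv

omit [DecidableEq ι] in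
/-- `euclideanPresentation Φ x = toEuclideanModel E (Φ x)`. [cite: Lange2023AbelianVarietiesComplex, §1.1.2 Lemma 1.1.11] -/
@[simp] theorem euclideanPresentation_apply (x : ι → ℝ) :
    euclideanPresentation Φ x = toEuclideanModel E (Φ x) := rfl

/-- The identity matrix acts trivially on real coordinates. [folklore] -/
private theorem one_map_intCast_mulVec' (x : ι → ℝ) :
    ((1 : Matrix ι ι ℤ).map (Int.cast : ℤ → ℝ)).mulVec x = x := by
  rw [Matrix.map_one Int.cast Int.cast_zero Int.cast_one, Matrix.one_mulVec]

/-- The change of presentation `ρ(1)` from the Euclidean presentation back to `Φ` has `ℂ`-linear analytic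
representation `(toEuclideanModel E)⁻¹`. [cite: Lange2023AbelianVarietiesComplex, §1.1.2 Lemma 1.1.11] -/
theorem apply_one_mulVec_eq_symm (x : ι → ℝ) :
    Φ (((1 : Matrix ι ι ℤ).map (Int.cast : ℤ → ℝ)).mulVec x) =
      ((toEuclideanModel E).symm : EuclideanSpace ℂ (Fin (finrank ℂ E)) →L[ℂ] E) (euclideanPresentation Φ x) := by
  rw [one_map_intCast_mulVec', euclideanPresentation_apply]
  exact ((toEuclideanModel E).symm_apply_apply (Φ x)).symm

/-- … and `ρ(1)` towards the Euclidean presentation has analytic representation `toEuclideanModel E`.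
[cite: Lange2023AbelianVarietiesComplex, §1.1.2 Lemma 1.1.11] -/
theorem euclideanPresentation_one_mulVec (x : ι → ℝ) :
    euclideanPresentation Φ (((1 : Matrix ι ι ℤ).map (Int.cast : ℤ → ℝ)).mulVec x) =
      (toEuclideanModel E : E →L[ℂ] EuclideanSpace ℂ (Fin (finrank ℂ E))) (Φ x) := by
  rw [one_map_intCast_mulVec']
  rfl

/-- **The change of presentation is a homeomorphism** `ComplexTorus (euclideanPresentation Φ) ≃ₜ ComplexTorus Φ`
(`ρ(1)` both ways, the identity on points). [cite: Lange2023AbelianVarietiesComplex, §1.1.2 Lemma 1.1.11] -/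
def euclideanPresentationHomeomorph : ComplexTorus (euclideanPresentation Φ) ≃ₜ ComplexTorus Φ where
  toFun := mapMatrix (euclideanPresentation Φ) Φ (1 : Matrix ι ι ℤ)
  invFun := mapMatrix Φ (euclideanPresentation Φ) (1 : Matrix ι ι ℤ)
  left_inv x := by rw [mapMatrix_one_eq, mapMatrix_one_eq]
  right_inv x := by rw [mapMatrix_one_eq, mapMatrix_one_eq]
  continuous_toFun := (contMDiff_real_mapMatrix (n := 0) (1 : Matrix ι ι ℤ)).continuous
  continuous_invFun := (contMDiff_real_mapMatrix (n := 0) (1 : Matrix ι ι ℤ)).continuous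

/-- `ρ(1)` is the identity on points. [cite: Lange2023AbelianVarietiesComplex, §1.1.2 Lemma 1.1.11] -/
theorem euclideanPresentationHomeomorph_apply (x : ComplexTorus (euclideanPresentation Φ)) :
    euclideanPresentationHomeomorph Φ x = (x : ι → AddCircle (1 : ℝ)) :=
  mapMatrix_one_eq _ _ x

/-- The change of presentation is holomorphic. [cite: Lange2023AbelianVarietiesComplex, §1.1.2 Lemma 1.1.11] -/
theorem mdifferentiable_euclideanPresentationHomeomorph :
    MDifferentiable 𝓘(ℂ, EuclideanSpace ℂ (Fin (finrank ℂ E))) 𝓘(ℂ, E) (euclideanPresentationHomeomorph Φ) :=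
  (contMDiff_mapMatrix (n := 1) ((toEuclideanModel E).symm : EuclideanSpace ℂ (Fin (finrank ℂ E)) →L[ℂ] E)
    (apply_one_mulVec_eq_symm Φ)).mdifferentiable one_ne_zero

/-- … with holomorphic inverse. [cite: Lange2023AbelianVarietiesComplex, §1.1.2 Lemma 1.1.11] -/
theorem mdifferentiable_euclideanPresentationHomeomorph_symm :
    MDifferentiable 𝓘(ℂ, E) 𝓘(ℂ, EuclideanSpace ℂ (Fin (finrank ℂ E))) (euclideanPresentationHomeomorph Φ).symm :=
  (contMDiff_mapMatrix (n := 1) (toEuclideanModel E : E →L[ℂ] EuclideanSpace ℂ (Fin (finrank ℂ E)))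
    (euclideanPresentation_one_mulVec Φ)).mdifferentiable one_ne_zero

omit [FiniteDimensional ℂ E] in
/-- The two models have the same dimension. [folklore] -/
private theorem finrank_euclideanModel_eq : finrank ℂ (EuclideanSpace ℂ (Fin (finrank ℂ E))) = finrank ℂ E :=
  finrank_euclideanSpace_fin

/-- **Pure dimension is preserved by the change of presentation**: a closed analytic subset `Z ⊆ X` of pure
dimension `d` is one of the Euclidean presentation (same points). [cite: Chirka1989, §2.3] -/
theorem _root_.Literature.Geometry.Kaehler.HasPureDim.euclideanPresentation {Z : Set (ComplexTorus Φ)} {d : ℕ}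
    (hZ : HasPureDim 𝓘(ℂ, E) Z d) :
    HasPureDim 𝓘(ℂ, EuclideanSpace ℂ (Fin (finrank ℂ E))) (euclideanPresentationHomeomorph Φ ⁻¹' Z) d :=
  hZ.preimage_homeomorph_of_finrank_eq (euclideanPresentationHomeomorph Φ)
    (mdifferentiable_euclideanPresentationHomeomorph Φ) (mdifferentiable_euclideanPresentationHomeomorph_symm Φ)
    finrank_euclideanModel_eq

/-- **Pure codimension is preserved by the change of presentation.** [cite: Chirka1989, §2.3] -/
theorem _root_.Literature.Geometry.Kaehler.HasPureCodim.euclideanPresentation {Z : Set (ComplexTorus Φ)} {c : ℕ}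
    (hZ : HasPureCodim 𝓘(ℂ, E) Z c) :
    HasPureCodim 𝓘(ℂ, EuclideanSpace ℂ (Fin (finrank ℂ E))) (euclideanPresentationHomeomorph Φ ⁻¹' Z) c :=
  hZ.preimage_homeomorph (euclideanPresentationHomeomorph Φ)
    (mdifferentiable_euclideanPresentationHomeomorph Φ) (mdifferentiable_euclideanPresentationHomeomorph_symm Φ)

/-- Conversely, from the Euclidean presentation back to `Φ`. [cite: Chirka1989, §2.3] -/
theorem _root_.Literature.Geometry.Kaehler.HasPureDim.of_euclideanPresentation
    {Z : Set (ComplexTorus (euclideanPresentation Φ))} {d : ℕ}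
    (hZ : HasPureDim 𝓘(ℂ, EuclideanSpace ℂ (Fin (finrank ℂ E))) Z d) :
    HasPureDim 𝓘(ℂ, E) ((euclideanPresentationHomeomorph Φ).symm ⁻¹' Z) d :=
  hZ.preimage_homeomorph_of_finrank_eq (euclideanPresentationHomeomorph Φ).symm
    (mdifferentiable_euclideanPresentationHomeomorph_symm Φ) (mdifferentiable_euclideanPresentationHomeomorph Φ)
    finrank_euclideanModel_eq.symm

/-! ### §2 Forms of the two presentations -/

/-- **The analytic representation of `ρ(1) : X → X_{L²}` is `toEuclideanModel E`.**
[cite: Lange2023AbelianVarietiesComplex, §1.1.2 (analytic representation)] -/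
theorem realRep_one_euclideanPresentation :
    realRep Φ (euclideanPresentation Φ) (1 : Matrix ι ι ℤ) =
      ((toEuclideanModel E : E →L[ℂ] EuclideanSpace ℂ (Fin (finrank ℂ E))).restrictScalars ℝ) := by
  refine ContinuousLinearMap.ext fun z ↦ ?_
  obtain ⟨x, rfl⟩ := Φ.surjective z
  rw [realRep_apply, one_map_intCast_mulVec']
  rfl

/-- The analytic representation of `ρ(1)` is `ℂ`-linear. [cite: Lange2023AbelianVarietiesComplex, §1.1.2 Lemma 1.1.11] -/
theorem realRep_one_euclideanPresentation_smul (c : ℂ) (u : E) :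
    realRep Φ (euclideanPresentation Φ) (1 : Matrix ι ι ℤ) (c • u) =
      c • realRep Φ (euclideanPresentation Φ) (1 : Matrix ι ι ℤ) u := by
  rw [realRep_one_euclideanPresentation, ContinuousLinearMap.coe_restrictScalars', ContinuousLinearEquiv.coe_coe,
    map_smul]

/-- **Pull-back along the change of presentation preserves integral Hodge classes**: for an integral
`(p,p)`-class `γ'` of the Euclidean presentation, `γ' ∘ toEuclideanModel` is an integral `(p,p)`-class of `Φ`
(same periods; `ℂ`-linear pull-back preserves type). [cite: Lange2023AbelianVarietiesComplex, §1.1.3 Exercise 1.1.6 (7) and §7.3.3 Exercise (1)] -/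
theorem comp_toEuclideanModel_mem_integralHodgeClasses {p : ℕ}
    {γ' : EuclideanSpace ℂ (Fin (finrank ℂ E)) [⋀^Fin (2 * p)]→L[ℝ] ℂ}
    (hγ' : γ' ∈ integralHodgeClasses (euclideanPresentation Φ) p) :
    γ'.compContinuousLinearMap (realRep Φ (euclideanPresentation Φ) (1 : Matrix ι ι ℤ)) ∈
      integralHodgeClasses Φ p := by
  rw [mem_integralHodgeClasses_iff] at hγ' ⊢
  exact ⟨comp_realRep_mem_integralForms Φ (euclideanPresentation Φ) 1 hγ'.1,
    hγ'.2.compContinuousLinearMap _ (realRep_one_euclideanPresentation_smul Φ)⟩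

/-- The same for rational Hodge classes `B^p`. [cite: Lange2023AbelianVarietiesComplex, §7.3.3 Exercise (1)] -/
theorem comp_toEuclideanModel_mem_hodgeClasses {p : ℕ}
    {γ' : EuclideanSpace ℂ (Fin (finrank ℂ E)) [⋀^Fin (2 * p)]→L[ℝ] ℂ}
    (hγ' : γ' ∈ hodgeClasses (euclideanPresentation Φ) p) :
    γ'.compContinuousLinearMap (realRep Φ (euclideanPresentation Φ) (1 : Matrix ι ι ℤ)) ∈ hodgeClasses Φ p :=
  comp_realRep_mem_hodgeClassesIn Φ (euclideanPresentation Φ) 1 (realRep_one_euclideanPresentation_smul Φ) hγ'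

/-- Pull-back along the (surjective) change of presentation is injective: `γ' ∘ toEuclideanModel = 0 ⇒ γ' = 0`.
[folklore] -/
private theorem eq_zero_of_comp_toEuclideanModel_eq_zero {k : ℕ}
    {γ' : EuclideanSpace ℂ (Fin (finrank ℂ E)) [⋀^Fin k]→L[ℝ] ℂ}
    (h : γ'.compContinuousLinearMap (realRep Φ (euclideanPresentation Φ) (1 : Matrix ι ι ℤ)) = 0) : γ' = 0 := by
  ext v
  have hv : (fun i ↦ realRep Φ (euclideanPresentation Φ) (1 : Matrix ι ι ℤ) ((toEuclideanModel E).symm (v i))) = v := by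
    funext i
    rw [realRep_one_euclideanPresentation, ContinuousLinearMap.coe_restrictScalars', ContinuousLinearEquiv.coe_coe,
      ContinuousLinearEquiv.apply_symm_apply]
  have h' := congrArg (fun δ : E [⋀^Fin k]→L[ℝ] ℂ ↦ δ (fun i ↦ (toEuclideanModel E).symm (v i))) h
  simp only [ContinuousAlternatingMap.compContinuousLinearMap_apply, Function.comp_def, hv,
    ContinuousAlternatingMap.coe_zero, Pi.zero_apply] at h'
  rw [h', ContinuousAlternatingMap.coe_zero, Pi.zero_apply]

/-! ### §3 The cycle-class obstruction in an arbitrary model -/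

/-- **No integral `(p,p)`-classes ⇒ no closed analytic subsets of codimension `p` — in ANY model.** For the torus
`X = E/Φ(ℤ^ι)` on a finite-dimensional complex normed space `E` (`rk Λ = 2d + 2p`): if every integral class of
type `(p,p)` in `H^{2p}(X, ℂ)` vanishes, then `X` has no closed analytic subset of pure dimension `d`. (The
class `[Z]` of such a `Z` is a non-zero integral `(p,p)`-class — Lelong; tree
`not_hasPureDim_of_forall_nonneg_integralHodgeClass_eq_zero` in the Euclidean presentation, transported by §1–§2.)
[cite: GriffithsHarrisPrinciples1978, Ch. 0 §2 and Ch. 3 §1] [cite: Chirka1989, §2.3] -/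
theorem not_hasPureDim_of_forall_integralHodgeClass_eq_zero {n d p : ℕ} (e : Fin n ≃ ι) (h : 2 * d + 2 * p = n)
    (hX : ∀ γ ∈ integralHodgeClasses Φ p, γ = 0) (Z : Set (ComplexTorus Φ)) : ¬ HasPureDim 𝓘(ℂ, E) Z d := by
  intro hZ
  refine not_hasPureDim_of_forall_nonneg_integralHodgeClass_eq_zero (euclideanPresentation Φ) e h
    (fun γ' hγ' _ ↦ ?_) _ hZ.euclideanPresentation
  exact eq_zero_of_comp_toEuclideanModel_eq_zero Φ (hX _ (comp_toEuclideanModel_mem_integralHodgeClasses Φ hγ'))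

/-- **`B^p(X) = 0` ⇒ no closed analytic subset of codimension `p`** (rational version, any model).
[cite: GriffithsHarrisPrinciples1978, Ch. 0 §2 and Ch. 3 §1] -/
theorem not_hasPureDim_of_hodgeClasses_eq_bot {n d p : ℕ} (e : Fin n ≃ ι) (h : 2 * d + 2 * p = n)
    (hX : hodgeClasses Φ p = ⊥) (Z : Set (ComplexTorus Φ)) : ¬ HasPureDim 𝓘(ℂ, E) Z d :=
  not_hasPureDim_of_forall_integralHodgeClass_eq_zero Φ e h
    (fun _ hγ ↦ (Submodule.mem_bot ℚ).1 (hX ▸ integralHodgeClasses_subset_hodgeClasses Φ p hγ)) Z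

/-- Codimension form: `B^p(X) = 0` ⇒ no closed analytic subset of pure codimension `p` (`dim E = d + p`,
`rk Λ = 2d + 2p`). [cite: GriffithsHarrisPrinciples1978, Ch. 0 §2 and Ch. 3 §1] -/
theorem not_hasPureCodim_of_hodgeClasses_eq_bot {n d p : ℕ} (e : Fin n ≃ ι) (h : 2 * d + 2 * p = n)
    (hd : d + p = finrank ℂ E) (hX : hodgeClasses Φ p = ⊥) (Z : Set (ComplexTorus Φ)) :
    ¬ HasPureCodim 𝓘(ℂ, E) Z p :=
  fun hZ ↦ not_hasPureDim_of_hodgeClasses_eq_bot Φ e h hX Z ⟨p, hd, hZ⟩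

end Model

end ComplexTorus

/-! ### §4 The explicit torus of Weil type carries no analytic hypersurface -/

namespace Weil

open ComplexTorus

/-- **The explicit complex torus of Weil type `X = ℂ⁴/Φ(ℤ⁸)` has no closed analytic subset of dimension
three** (no analytic hypersurface): `H²_Hodge(X) = NS(X) ⊗ ℚ = 0` (`Weil.hodgeClasses_one_eq_bot`), and the
class of a hypersurface would be a non-zero element of it. Voisin's assumption (b) in codimension one for this
torus; Lange's "a torus with `X_a = 0` carries no analytic hypersurface" for the tree's explicit example.
[cite: Voisin2002KaehlerCounterexample, §2 (a)–(b) and §3 Prop. 3 (i)] [cite: Lange2023AbelianVarietiesComplex, §2.1.6 Exercise (8)(g)] -/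
theorem not_hasPureDim_three (Z : Set (ComplexTorus periodEquiv)) : ¬ HasPureDim 𝓘(ℂ, Fin 4 → ℂ) Z 3 :=
  not_hasPureDim_of_hodgeClasses_eq_bot periodEquiv (n := 8) (d := 3) (p := 1) (Equiv.refl (Fin 8))
    (by norm_num) hodgeClasses_one_eq_bot Z

/-- **The explicit torus of Weil type has no closed analytic subset of pure codimension one** (no divisor).
[cite: Voisin2002KaehlerCounterexample, §2 (a)–(b) and §3 Prop. 3 (i)] [cite: Lange2023AbelianVarietiesComplex, §2.1.6 Exercise (8)(g)] -/
theorem not_hasPureCodim_one (Z : Set (ComplexTorus periodEquiv)) : ¬ HasPureCodim 𝓘(ℂ, Fin 4 → ℂ) Z 1 :=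
  not_hasPureCodim_of_hodgeClasses_eq_bot periodEquiv (n := 8) (d := 3) (p := 1) (Equiv.refl (Fin 8))
    (by norm_num) (by simp) hodgeClasses_one_eq_bot Z

end Weil

end Literature.Geometry.Kaehler

end
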